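import Literature.NumberTheory.Automorphic.ArchEndoscopicOrbitalMeasureLeaves     -- ★ p850437 (this seat): per-place leaves `exists_splitLeaf_map_descConj_hypBlockGL`, `map_descConj_quotientMeasure_eq_smul_map_pair_one`
import Literature.NumberTheory.Automorphic.ArchEndoscopicChartOrbPlaces          -- ★ p850200∕p850227 (LH3-p03 (g3)): `compactSpace_chartTorusHLoc_of_not_mem`, `isInvInvariant_of_isHaarMeasure_archOne`; brings ★ D1∕D2 `chartTorusHLoc`, `chartHaarHLoc`, ★ package p850180, ★ (T-MEAS) `chartOrbH`, ★ `chartOrbH_eq_of_isHaarMeasure`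
import Literature.NumberTheory.Automorphic.ArchEndoscopicChartSplitDock           -- ★ p850300 (LH3-p01 (g3)): `chartTorusHLoc_eq_torusU`, `endoBlockAt_eq_mk_hypBlockGL`
import Literature.NumberTheory.Automorphic.ArchEndoscopicChartOrbitalContinuity   -- ★ p849873 (F0P3a-p09 (g5)): `isCompact_setOf_exists_conj_endoBlock_mem_of_not_mem` (compact place: Harish-Chandra properness)
import Literature.NumberTheory.Automorphic.ArchCartanNormalisers                  -- ★ p849550 (LH3-p01 (g3)): `archRH`
import Literature.NumberTheory.Rogawski1990.ArchWallOrbitMeasureProduct           -- ★ `Literature.MeasureTheory.Group.pi_nnreal_smul_map`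
import Literature.NumberTheory.Automorphic.ArchChartOrbHaarScaling                 -- ★ (LH3-p03 (g3)): `chartOrbH_eq_haarScalarFactor_mul`, `isHaarMeasure_prodConventionH`, `isMulRightInvariant_prodConventionH`
import HarnessLib

/-!
# UNIFORM UNFOLDING of the normalised chart orbital functional of `H_∞` on the regular set: `R_S(c) · chartOrbH νH S fH c = K₀ · E_S(c) · ∫_{A × A} fH((a₁,1)·γ_S(c)·(a₂,1)·(a₁,1)⁻¹) dΛ`
# with ONE fixed measure `Λ` for all `c`, and NO singularity at the real walls `x_w = 0` ((M1b′) of the LH3 direct road; Harish-Chandra's `F_f^A` at every split place at once)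

Topic `NumberTheory/Automorphic`; namespace `Literature.NumberTheory.Automorphic.UnitaryGroup`.  THEOREMS ONLY (no `def`, no instance, no axiom, no `sorry`).
Cell `pub/hodgecm-mathlib`, crux H413 (`stmt-HodgeConjecture-24833`), line LH3 (closer stub `stub_N9`, DIRECT ROAD), organ O-L3′ clause (SB-H) = [C1b]
(LH3-plan (g3) RULINGS #7 (d), 2026-09-02), brick (M1b′), assembly half.  Author LH3-p01 (g4).  Count-neutral.

THE MATHEMATICS.  `H_∞ = A × B`, `A = U(Φ₂)(L⁺ ⊗ ℝ) ≃ Π_w G_w` (`eA = archPiEquivCM 2 L Φ₂`, `G_w = U(Φ₂)_w`), `B = U(Φ₁)(L⁺ ⊗ ℝ)`; the chart torus `T_S` is placewise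
(★ D1) and contains `B`.  For a coordinate `c` regular at every place (`c ∈ RegS S`: `x_w ≠ 0` at `w ∈ S`, `e^{ic_w0} ≠ e^{ic_w2}` at `w ∉ S`):
(1) ★ package p850180 (cov clause): `chartOrbH νH S fH c = ρ(B_S) · ∫_{Π_w G_w ⧸ T_{S,w}} fH(eA⁻¹ (x_w γ_w x_w⁻¹)_w, b) d(⊗_w ν_w∕ρ_w)`, `γ_w = endoBlockAt S w (c w)`,
`b = (endoTorus S c).2`; (2) Mathlib `Measure.pi_map_pi`: this is `∫_{Π_w G_w} fH(eA⁻¹ g, b) d(⊗_w O_w)` with `O_w` the ORBITAL MEASURE of `γ_w`; (3) ★ p850437: at EVERY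
place `O_w = (C_w d_w(c)) • (z ↦ z₁ (γ_w z₂) z₁⁻¹)_* Λ_w` for a FIXED measure `Λ_w` on `G_w × G_w` carried by a closed leaf `Z_w` (`K_w × N_w` at a split place, with
`d_w(c) = |e^{−2x_w} − 1|⁻¹`; `G_w × {1}` at a compact place, `d_w = 1`), so by ★ `pi_nnreal_smul_map` the whole is `(Π_w C_w d_w(c)) · ∫_{Π_w G_w × G_w} fH(…) d(⊗_w Λ_w)`;
(4) folding `Π_w (G_w × G_w) ≅ A × A` along `eA⁻¹ × eA⁻¹`: `∫_{A × A} fH((a₁, 1) · (endoTorus S c · (a₂, 1)) · (a₁, 1)⁻¹) dΛ`; (5) multiplying by Shelstad's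
`R_S(c) = Π_{w∈S} |e^{x_w} − e^{−x_w}| · Π_{w∉S} (1 − e^{i(c_w2 − c_w0)})` (★ `archRH`) and using `|eˣ − e⁻ˣ| · |e^{−2x} − 1|⁻¹ = eˣ` (★ `abs_exp_sub_exp_neg_mul_norm_inv`):
  **`archRH S c · chartOrbH L νH S fH c = K₀ · (Π_w [w ∈ S ? e^{x_w} : (1 − e^{i(c_w2−c_w0)})]) · ∫_{A×A} fH((a₁,1)·(endoTorus S c·(a₂,1))·(a₁,1)⁻¹) dΛ`**
with `K₀`, `Λ` INDEPENDENT of `c` and of `fH` — the right-hand side is manifestly smooth in `c` across `x_w = 0` (FILE V `ArchBouazizStableFamilySlabSmooth`).  The leaf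
`Z ⊆ A × A` carrying `Λ` is UNIFORMLY PROPER for the map `(z, c) ↦ (z₁,1)·(endoTorus S c·(z₂,1))·(z₁,1)⁻¹` over compacts of coordinates regular at the compact places
(split places: `K_w` compact and `N_w` closed, no regularity; compact places: ★ `isCompact_setOf_exists_conj_endoBlock_mem_of_not_mem`) — the support clause of the
smoothness engine.
* §1 `exists_placeLeaf` — the per-place package in the `archLocal` currency, uniform in the kind of place (split: ★ `exists_splitLeaf_map_descConj_hypBlockGL` docked through ★
  `chartTorusHLoc_eq_torusU`; compact: ★ `map_descConj_quotientMeasure_eq_smul_map_pair_one`, `T_{S,w}` compact).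
* §2 HEAD `exists_leafMeasure_archRH_mul_chartOrbH_eq` (product Haar convention `νH = (eA⁻¹_* ⊗ ν_w) ⊗ ν_B`) and `exists_leafMeasure_archRH_mul_chartOrbH_eq_of_isHaarMeasure`
  (ARBITRARY Haar `νH`, ★ `chartOrbH_eq_haarScalarFactor_mul`).
HONEST LABEL: HC_CM is proved only modulo the 7 printed citations (2 remaining: hLiu418 = stmt-HodgeConjecture-24832, h413 = stmt-HodgeConjecture-24833) until rung 0
closes; measure-theoretic bookkeeping over Mathlib + ★ kit, pays nothing by itself.

## References
* [Varadarajan1989] V. S. Varadarajan, *An Introduction to Harmonic Analysis on Semisimple Lie Groups* (1989), §6.4 Lemma 21, Thm 23 (`F_f^A`).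
* [Shelstad1979] D. Shelstad, *Characters and inner forms of a quasi-split group over ℝ*, Compositio Math. 39 (1979), §4 pp. 22–25 (`R_T`, `Ψ^T_f`, Lemma 4.3).
* [Rogawski1990] J. D. Rogawski, *Automorphic Representations of Unitary Groups in Three Variables*, Ann. of Math. Stud. 123 (1990), §4.9 p. 55, §8.2 pp. 119–122.
* [Folland1995] G. B. Folland, *A Course in Abstract Harmonic Analysis* (1995), §2.6 Thm. 2.49, (2.52).
* [BorelJacquet1979] A. Borel, H. Jacquet, *Automorphic forms and automorphic representations*, PSPM 33.1 (1979), §4.1 (`G_∞ = Π_v G(F_v)`).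
-/

set_option autoImplicit false

noncomputable section

open MeasureTheory MeasureTheory.Measure NumberField NumberField.InfinitePlace Matrix Complex Topology Set
open Literature.MeasureTheory.Group Literature.NumberTheory.Automorphic.ArchCartan
open scoped MatrixGroups Matrix ENNReal NNReal ComplexConjugate Classical Pointwise

namespace Literature.NumberTheory.Automorphic.UnitaryGroup

local notation3 "Φ₂[" L "]" => (Matrix.of fun i j : Fin 2 => if i.val + j.val + 1 = 2 then (1 : L) else 0)
local notation3 "Φ₁[" L "]" => (Matrix.of fun i j : Fin 1 => if i.val + j.val + 1 = 1 then (1 : L) else 0)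

/-! ## §1 The per-place leaf package in the `archLocal` currency -/

section PlaceLeaf

variable (L : Type) [Field L] [NumberField L] [IsCMField L] (S : Finset {w : InfinitePlace L // IsComplex w}) (w : {w : InfinitePlace L // IsComplex w})
  [MeasurableSpace ↥(archLocal L 2 Φ₂[L] w)] [BorelSpace ↥(archLocal L 2 Φ₂[L] w)]
  [LocallyCompactSpace ↥(archLocal L 2 Φ₂[L] w)] [SecondCountableTopology ↥(archLocal L 2 Φ₂[L] w)]
  (νw : Measure ↥(archLocal L 2 Φ₂[L] w)) [νw.IsHaarMeasure] [νw.IsMulRightInvariant]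

/-- `descConj` does not see the proof that the subgroup centralises the point: equal points give equal orbital integrands. [folklore] -/
private theorem descConj_congr_point {G : Type*} [Group G] {γ γ' : G} (M : Subgroup G) (h : ∀ m ∈ M, m * γ = γ * m) (h' : ∀ m ∈ M, m * γ' = γ' * m)
    (hγ : γ = γ') {α : Type*} (F : G → α) : descConj γ M h F = descConj γ' M h' F := by
  subst hγ; rfl

omit [NumberField L] [IsCMField L] [MeasurableSpace ↥(archLocal L 2 Φ₂[L] w)] [BorelSpace ↥(archLocal L 2 Φ₂[L] w)]
  [LocallyCompactSpace ↥(archLocal L 2 Φ₂[L] w)] [SecondCountableTopology ↥(archLocal L 2 Φ₂[L] w)] in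
/-- `σ_w(Φ₂) = Φ₂` as a complex matrix: the local form at every complex place is the anti-diagonal standard form (★ `antidiagOne_map`, ★ `StdForm.over_antidiagonal_eq`).
[cite: Rogawski1990, §3.6 p. 31] -/
theorem map_embedding_antidiagTwo_eq_over : (Φ₂[L]).map w.1.embedding = (StdForm.antidiagonal 2).over ℂ := by
  rw [Literature.NumberTheory.Rogawski1990.antidiagOne_map, StdForm.over_antidiagonal_eq]

/-- **SPLIT TORUS AS A VARIABLE** (the docking device of ★ `ArchEndoscopicChartSplitDock`, in the `U(conj, J)(ℂ)` currency): for a subgroup `T′ = torusU` (by `subst`),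
any inversion-invariant Haar measure `t` on it and a chart `γ` with `γ(cw) = hypBlockGL (cw 0) (cw 2)`, the leaf package of ★ `exists_splitLeaf_map_descConj_hypBlockGL` for the
canonical quotient measure `ν ∕ t`, read at the chart points with `cw 0 ≠ 0`.  All instance binders are NAMED so that a consumer whose group is a definitional copy of
`U(conj, J)(ℂ)` (★ `archLocal L 2 Φ₂ w`) can pass its own instances. [cite: Varadarajan1989, §6.4 Lemma 21] [cite: Rogawski1990, §4.9 p. 55] -/
theorem exists_leaf_of_eq_torusU {J : Matrix (Fin 2) (Fin 2) ℂ} (hJ : J = (StdForm.antidiagonal 2).over ℂ)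
    [iM : MeasurableSpace ↥(unitaryGroupOfForm (starRingEnd ℂ) J)] [iB : BorelSpace ↥(unitaryGroupOfForm (starRingEnd ℂ) J)]
    [iLC : LocallyCompactSpace ↥(unitaryGroupOfForm (starRingEnd ℂ) J)] [iSC : SecondCountableTopology ↥(unitaryGroupOfForm (starRingEnd ℂ) J)]
    {T' : Subgroup ↥(unitaryGroupOfForm (starRingEnd ℂ) J)} (hT' : T' = torusU (starRingEnd ℂ) J)
    (hT'c : IsClosed (T' : Set ↥(unitaryGroupOfForm (starRingEnd ℂ) J)))
    [iMq : MeasurableSpace (↥(unitaryGroupOfForm (starRingEnd ℂ) J) ⧸ T')] [iBq : BorelSpace (↥(unitaryGroupOfForm (starRingEnd ℂ) J) ⧸ T')]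
    (t : Measure ↥T') [it : t.IsHaarMeasure] [iti : t.IsInvInvariant]
    (ν : Measure ↥(unitaryGroupOfForm (starRingEnd ℂ) J)) [iν : ν.IsHaarMeasure] [iνr : ν.IsMulRightInvariant]
    (γ : (Fin 3 → ℝ) → ↥(unitaryGroupOfForm (starRingEnd ℂ) J))
    (hγ : ∀ cw, γ cw = ⟨hypBlockGL (cw 0) (cw 2), hypBlockGL_mem_of_eq_over hJ (cw 0) (cw 2)⟩) (hcomm : ∀ cw, ∀ m ∈ T', m * γ cw = γ cw * m) :
    ∃ (Λw : Measure (↥(unitaryGroupOfForm (starRingEnd ℂ) J) × ↥(unitaryGroupOfForm (starRingEnd ℂ) J)))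
      (Zw : Set (↥(unitaryGroupOfForm (starRingEnd ℂ) J) × ↥(unitaryGroupOfForm (starRingEnd ℂ) J))) (Cw : ℝ≥0),
      IsFiniteMeasureOnCompacts Λw ∧ IsClosed Zw ∧ Λw Zwᶜ = 0 ∧ Cw ≠ 0 ∧
      (∀ E : Set ↥(unitaryGroupOfForm (starRingEnd ℂ) J), IsCompact E → ∀ C' : Set ↥(unitaryGroupOfForm (starRingEnd ℂ) J), IsCompact C' →
        ∃ 𝒮 : Set (↥(unitaryGroupOfForm (starRingEnd ℂ) J) × ↥(unitaryGroupOfForm (starRingEnd ℂ) J)), IsCompact 𝒮 ∧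
          ∀ z ∈ Zw, ∀ g ∈ E, z.1 * (g * z.2) * z.1⁻¹ ∈ C' → z ∈ 𝒮) ∧
      ∀ cw : Fin 3 → ℝ, cw 0 ≠ 0 →
        Measure.map (descConj (γ cw) T' (hcomm cw) id) (quotientMeasure T' t hT'c ν) =
          (Cw * ‖(((Real.exp (-2 * cw 0) : ℝ) : ℂ)) - 1‖₊⁻¹) •
            Measure.map (fun z : ↥(unitaryGroupOfForm (starRingEnd ℂ) J) × ↥(unitaryGroupOfForm (starRingEnd ℂ) J) => z.1 * (γ cw * z.2) * z.1⁻¹) Λw := by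
  subst hT'
  haveI : LocallyCompactSpace ↥(torusU (starRingEnd ℂ) J) := hT'c.isClosedEmbedding_subtypeVal.locallyCompactSpace
  -- the canonical quotient measure `ν ∕ t` is a non-zero invariant Radon measure
  set μ := quotientMeasure (torusU (starRingEnd ℂ) J) t hT'c ν with hμdef
  haveI : SMulInvariantMeasure ↥(unitaryGroupOfForm (starRingEnd ℂ) J) (↥(unitaryGroupOfForm (starRingEnd ℂ) J) ⧸ torusU (starRingEnd ℂ) J) μ :=
    smulInvariantMeasure_quotientMeasure _ t hT'c ν
  have hμ : μ ≠ 0 := quotientMeasure_ne_zero _ t hT'c ν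
  obtain ⟨K, hK, Λ, hΛc, C, hC, hnull, hleaf⟩ := exists_splitLeaf_map_descConj_hypBlockGL hJ μ hμ
  refine ⟨Λ, K ×ˢ (unipotentU (starRingEnd ℂ) J : Set ↥(unitaryGroupOfForm (starRingEnd ℂ) J)), C, hΛc,
    hK.isClosed.prod (LineRing.isClosed_unipotentU (starRingEnd ℂ) J), hnull, hC, ?_, ?_⟩
  · -- properness on the leaf `K × N`: `z₁ ∈ K`, `z₂ ∈ g⁻¹ z₁⁻¹ C′ z₁ ⊆ E⁻¹ K⁻¹ C′ K`
    intro E hE C' hC'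
    refine ⟨K ×ˢ (E⁻¹ * K⁻¹ * C' * K), hK.prod (((hE.inv.mul hK.inv).mul hC').mul hK), ?_⟩
    rintro z ⟨hz1, -⟩ g hg hmem
    refine ⟨hz1, ?_⟩
    have h : z.2 = g⁻¹ * z.1⁻¹ * (z.1 * (g * z.2) * z.1⁻¹) * z.1 := by group
    rw [h]
    exact Set.mul_mem_mul (Set.mul_mem_mul (Set.mul_mem_mul (Set.inv_mem_inv.2 hg) (Set.inv_mem_inv.2 hz1)) hmem) hz1
  · intro cw hcw
    rw [descConj_congr_point _ (hcomm cw) (LineRing.forall_mem_torusU_comm (starRingEnd ℂ) J (hypBlockGL_mem_torusU hJ (cw 0) (cw 2))) (hγ cw) id, hγ cw]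
    exact hleaf (cw 2) (cw 0) hcw

/-- **THE PER-PLACE LEAF PACKAGE** (uniform in the kind of place).  At each complex place `w` there are a measure `Λ_w` on `G_w × G_w` (`G_w = U(Φ₂)_w`) finite on
compacta, a CLOSED leaf `Z_w` carrying it, and `C_w ≠ 0`, such that (PROPER) for every compact `U` of coordinates — regular at `w` if `w` is a compact place — and every
compact `C′ ⊆ G_w` the leaf points `z` with `z₁ (γ_w(c) z₂) z₁⁻¹ ∈ C′` for some `c ∈ U` lie in one compact set, and (LEAF) the orbital measure of the chart point
`γ_w(c) = endoBlockAt S w (c w)` is `(C_w · d_w(c)) • (z ↦ z₁ (γ_w(c) z₂) z₁⁻¹)_* Λ_w` with `d_w(c) = |e^{−2x_w} − 1|⁻¹` at a split place (`x_w ≠ 0`) and `d_w = 1` at a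
compact place.  (Split: ★ `exists_splitLeaf_map_descConj_hypBlockGL` through ★ `chartTorusHLoc_eq_torusU`; compact: ★ `map_descConj_quotientMeasure_eq_smul_map_pair_one`,
`T_{S,w}` compact ★ `compactSpace_chartTorusHLoc_of_not_mem`, properness ★ `isCompact_setOf_exists_conj_endoBlock_mem_of_not_mem`.)
[cite: Varadarajan1989, §6.4 Lemma 21, Thm 23] [cite: Rogawski1990, §8.2 pp. 119–122] [cite: Folland1995, §2.6 (2.52)] -/
theorem exists_placeLeaf
    [MeasurableSpace (↥(archLocal L 2 Φ₂[L] w) ⧸ chartTorusHLoc L S w)] [BorelSpace (↥(archLocal L 2 Φ₂[L] w) ⧸ chartTorusHLoc L S w)]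
    [(chartHaarHLoc L S w).IsHaarMeasure] [(chartHaarHLoc L S w).IsInvInvariant] :
    ∃ (Λw : Measure (↥(archLocal L 2 Φ₂[L] w) × ↥(archLocal L 2 Φ₂[L] w))) (Zw : Set (↥(archLocal L 2 Φ₂[L] w) × ↥(archLocal L 2 Φ₂[L] w))) (Cw : ℝ≥0),
      IsFiniteMeasureOnCompacts Λw ∧ IsClosed Zw ∧ Λw Zwᶜ = 0 ∧ Cw ≠ 0 ∧
      (∀ U : Set ({w : InfinitePlace L // IsComplex w} → Fin 3 → ℝ), IsCompact U → (w ∉ S → ∀ c ∈ U, Circle.exp (c w 0) ≠ Circle.exp (c w 2)) →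
        ∀ C' : Set ↥(archLocal L 2 Φ₂[L] w), IsCompact C' →
          ∃ 𝒮 : Set (↥(archLocal L 2 Φ₂[L] w) × ↥(archLocal L 2 Φ₂[L] w)), IsCompact 𝒮 ∧
            ∀ z ∈ Zw, ∀ c ∈ U, z.1 * (endoBlockAt L S w (c w) * z.2) * z.1⁻¹ ∈ C' → z ∈ 𝒮) ∧
      ∀ c : {w : InfinitePlace L // IsComplex w} → Fin 3 → ℝ, (w ∈ S → c w 0 ≠ 0) →
        Measure.map (descConj (endoBlockAt L S w (c w)) (chartTorusHLoc L S w) (forall_mem_chartTorusHLoc_comm L S w (c w)) id)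
            (quotientMeasure (chartTorusHLoc L S w) (chartHaarHLoc L S w) (isClosed_chartTorusHLoc L S w) νw) =
          (Cw * (if w ∈ S then ‖(((Real.exp (-2 * c w 0) : ℝ) : ℂ)) - 1‖₊⁻¹ else 1)) •
            Measure.map (fun z : ↥(archLocal L 2 Φ₂[L] w) × ↥(archLocal L 2 Φ₂[L] w) => z.1 * (endoBlockAt L S w (c w) * z.2) * z.1⁻¹) Λw := by
  haveI := sigmaFinite_chartHaarHLoc L S w
  haveI := locallyCompactSpace_chartTorusHLoc L S w
  by_cases hw : w ∈ S
  · -- SPLIT place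
    have hJ : (Φ₂[L]).map w.1.embedding = (StdForm.antidiagonal 2).over ℂ := map_embedding_antidiagTwo_eq_over L w
    -- `U(Φ₂)_w = U(conj, σ_w Φ₂)(ℂ)` by DEFINITION of ★ `archLocal`: the instances in scope, restated at the unfolded type (instance-resolution keys)
    letI jM : MeasurableSpace ↥(unitaryGroupOfForm (starRingEnd ℂ) ((Φ₂[L]).map w.1.embedding)) := ‹MeasurableSpace ↥(archLocal L 2 Φ₂[L] w)›
    haveI jB : BorelSpace ↥(unitaryGroupOfForm (starRingEnd ℂ) ((Φ₂[L]).map w.1.embedding)) := ‹BorelSpace ↥(archLocal L 2 Φ₂[L] w)›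
    haveI jLC : LocallyCompactSpace ↥(unitaryGroupOfForm (starRingEnd ℂ) ((Φ₂[L]).map w.1.embedding)) := ‹LocallyCompactSpace ↥(archLocal L 2 Φ₂[L] w)›
    haveI jSC : SecondCountableTopology ↥(unitaryGroupOfForm (starRingEnd ℂ) ((Φ₂[L]).map w.1.embedding)) := ‹SecondCountableTopology ↥(archLocal L 2 Φ₂[L] w)›
    letI jMq : MeasurableSpace (↥(unitaryGroupOfForm (starRingEnd ℂ) ((Φ₂[L]).map w.1.embedding)) ⧸ chartTorusHLoc L S w) :=
      ‹MeasurableSpace (↥(archLocal L 2 Φ₂[L] w) ⧸ chartTorusHLoc L S w)›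
    haveI jBq : BorelSpace (↥(unitaryGroupOfForm (starRingEnd ℂ) ((Φ₂[L]).map w.1.embedding)) ⧸ chartTorusHLoc L S w) :=
      ‹BorelSpace (↥(archLocal L 2 Φ₂[L] w) ⧸ chartTorusHLoc L S w)›
    obtain ⟨Λw, Zw, Cw, hΛc, hZc, hnull, hC, hprop, hleaf⟩ :=
      @exists_leaf_of_eq_torusU ((Φ₂[L]).map w.1.embedding) hJ jM jB jLC jSC (chartTorusHLoc L S w) (chartTorusHLoc_eq_torusU L S hw) (isClosed_chartTorusHLoc L S w)
        jMq jBq (chartHaarHLoc L S w) ‹(chartHaarHLoc L S w).IsHaarMeasure› ‹(chartHaarHLoc L S w).IsInvInvariant›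
        νw ‹νw.IsHaarMeasure› ‹νw.IsMulRightInvariant›
        (fun cw => endoBlockAt L S w cw) (fun cw => endoBlockAt_eq_mk_hypBlockGL L S hw cw) (fun cw => forall_mem_chartTorusHLoc_comm L S w cw)
    refine ⟨Λw, Zw, Cw, hΛc, hZc, hnull, hC, fun U hU _ C' hC' => ?_, fun c hc => ?_⟩
    · obtain ⟨𝒮, h𝒮, h⟩ := hprop ((fun c : {w : InfinitePlace L // IsComplex w} → Fin 3 → ℝ => endoBlockAt L S w (c w)) '' U)
        (hU.image ((continuous_endoBlockAt L S w).comp (continuous_apply w))) C' hC'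
      exact ⟨𝒮, h𝒮, fun z hz c hcU hmem => h z hz _ ⟨c, hcU, rfl⟩ hmem⟩
    · rw [if_pos hw]
      exact hleaf (c w) (hc hw)
  · -- COMPACT place: the leaf `G_w × {1}`
    haveI : CompactSpace ↥(chartTorusHLoc L S w) := compactSpace_chartTorusHLoc_of_not_mem L S w hw
    have hne : chartHaarHLoc L S w Set.univ ≠ 0 := (isOpen_univ.measure_pos (chartHaarHLoc L S w) univ_nonempty).ne'
    have hlt : chartHaarHLoc L S w Set.univ ≠ ⊤ := (isCompact_univ.measure_lt_top (μ := chartHaarHLoc L S w)).ne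
    have hι : IsClosedEmbedding (fun g : ↥(archLocal L 2 Φ₂[L] w) => (g, (1 : ↥(archLocal L 2 Φ₂[L] w)))) := by
      refine ⟨isEmbedding_graph continuous_const, ?_⟩
      have hr : Set.range (fun g : ↥(archLocal L 2 Φ₂[L] w) => (g, (1 : ↥(archLocal L 2 Φ₂[L] w)))) = Set.univ ×ˢ {1} := by
        ext z
        simp only [Set.mem_range, Set.mem_prod, Set.mem_univ, Set.mem_singleton_iff, true_and]
        constructor
        · rintro ⟨g, rfl⟩; rfl
        · intro h; exact ⟨z.1, Prod.ext rfl h.symm⟩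
      rw [hr]
      exact isClosed_univ.prod isClosed_singleton
    refine ⟨Measure.map (fun g : ↥(archLocal L 2 Φ₂[L] w) => (g, (1 : ↥(archLocal L 2 Φ₂[L] w)))) νw, Set.univ ×ˢ {1},
      (chartHaarHLoc L S w Set.univ).toNNReal⁻¹, ?_, isClosed_univ.prod isClosed_singleton, ?_,
      inv_ne_zero (ENNReal.toNNReal_ne_zero.2 ⟨hne, hlt⟩), fun U hU hreg C' hC' => ?_, fun c _ => ?_⟩
    · refine ⟨fun C' hC' => ?_⟩
      rw [hι.measurableEmbedding.map_apply]
      exact (hι.isCompact_preimage hC').measure_lt_top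
    · rw [hι.measurableEmbedding.map_apply]
      have hempty : (fun g : ↥(archLocal L 2 Φ₂[L] w) => (g, (1 : ↥(archLocal L 2 Φ₂[L] w)))) ⁻¹' (Set.univ ×ˢ {1})ᶜ = ∅ := by
        ext g
        simp only [Set.mem_preimage, Set.mem_compl_iff, Set.mem_prod, Set.mem_univ, Set.mem_singleton_iff, and_self, not_true_eq_false,
          Set.mem_empty_iff_false]
      rw [hempty, measure_empty]
    · refine ⟨{y : ↥(archLocal L 2 Φ₂[L] w) | ∃ c ∈ U, y * endoBlock L S c w * y⁻¹ ∈ C'} ×ˢ {1},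
        (isCompact_setOf_exists_conj_endoBlock_mem_of_not_mem L w S hw hU (hreg hw) hC').prod isCompact_singleton, ?_⟩
      rintro z ⟨-, hz2⟩ c hcU hmem
      rw [Set.mem_singleton_iff] at hz2
      refine ⟨⟨c, hcU, ?_⟩, hz2⟩
      rw [hz2, mul_one] at hmem
      exact hmem
    · rw [if_neg hw, mul_one]
      exact map_descConj_quotientMeasure_eq_smul_map_pair_one (chartTorusHLoc L S w) (isClosed_chartTorusHLoc L S w) (chartHaarHLoc L S w) νw
        (endoBlockAt L S w (c w)) (forall_mem_chartTorusHLoc_comm L S w (c w))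

end PlaceLeaf

/-! ## §2 The assembly over all places, folded to `A × A` -/

section Generic

/-- **A measure carried by a closed leaf on which a continuous map is proper is pushed forward to a measure finite on compacta.** [folklore] -/
private theorem isFiniteMeasureOnCompacts_map_of_leaf {X Y : Type*} [TopologicalSpace X] [MeasurableSpace X] [BorelSpace X] [TopologicalSpace Y] [T2Space Y]
    [MeasurableSpace Y] [BorelSpace Y] (μ : Measure X) [IsFiniteMeasureOnCompacts μ] {Z : Set X} (hZ : μ Zᶜ = 0) {m : X → Y} (hm : Continuous m)
    (hprop : ∀ C : Set Y, IsCompact C → ∃ 𝒮 : Set X, IsCompact 𝒮 ∧ ∀ z ∈ Z, m z ∈ C → z ∈ 𝒮) : IsFiniteMeasureOnCompacts (μ.map m) := by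
  refine ⟨fun C hC => ?_⟩
  obtain ⟨𝒮, h𝒮, h⟩ := hprop C hC
  rw [Measure.map_apply hm.measurable hC.measurableSet]
  have hsub : m ⁻¹' C ⊆ 𝒮 ∪ Zᶜ := fun z hz => by
    by_cases hzZ : z ∈ Z
    · exact Or.inl (h z hzZ hz)
    · exact Or.inr hzZ
  calc μ (m ⁻¹' C) ≤ μ (𝒮 ∪ Zᶜ) := measure_mono hsub
    _ ≤ μ 𝒮 + μ Zᶜ := measure_union_le _ _
    _ < ⊤ := by rw [hZ, add_zero]; exact h𝒮.measure_lt_top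

end Generic

section Assembly

local notation3 "𝔸[" L "]" => ↥(arch (↥(maximalRealSubfield L)) L (IsCMField.complexConj L) 2 Φ₂[L])
local notation3 "𝔹[" L "]" => ↥(arch (↥(maximalRealSubfield L)) L (IsCMField.complexConj L) 1 Φ₁[L])

variable (L : Type) [Field L] [NumberField L] [IsCMField L] (S : Finset {w : InfinitePlace L // IsComplex w})
  [∀ w : {w : InfinitePlace L // IsComplex w}, MeasurableSpace ↥(archLocal L 2 Φ₂[L] w)]
  [∀ w : {w : InfinitePlace L // IsComplex w}, BorelSpace ↥(archLocal L 2 Φ₂[L] w)]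
  [MeasurableSpace 𝔸[L]] [BorelSpace 𝔸[L]] [MeasurableSpace 𝔹[L]] [BorelSpace 𝔹[L]]
  (νw : ∀ w : {w : InfinitePlace L // IsComplex w}, Measure ↥(archLocal L 2 Φ₂[L] w)) [∀ w, (νw w).IsHaarMeasure] [∀ w, (νw w).IsMulRightInvariant]
  (νB : Measure 𝔹[L]) [νB.IsHaarMeasure] [νB.IsMulRightInvariant]
  (νH : Measure (𝔸[L] × 𝔹[L])) [νH.IsHaarMeasure] [νH.IsMulRightInvariant]
  (hν : νH = ((Measure.pi νw).map (archPiEquivCM 2 L Φ₂[L]).symm).prod νB)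

set_option maxHeartbeats 400000 in
include hν in
/-- **UNIFORM UNFOLDING (product Haar convention).**  For `νH = (eA⁻¹_* ⊗_w ν_w) ⊗ ν_B`, every label `S` and every continuous `fH` on `H_∞ = A × B` there are a real constant
`K₀`, a measure `Λ` on `A × A` finite on compacta and a CLOSED leaf `Z ⊆ A × A` carrying `Λ` — all independent of the coordinate `c` — such that
(PROPER) for every compact `U` of coordinates regular at the compact places of `S` and every compact `C ⊆ H_∞` the leaf points `z` with
`(z₁,1)·(endoTorus S c·(z₂,1))·(z₁,1)⁻¹ ∈ C` for some `c ∈ U` lie in one compact, and (IDENTITY) for every `c ∈ RegS S`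
`archRH S c · chartOrbH L νH S fH c = K₀ · (Π_w [w ∈ S ? e^{c_w0} : 1 − e^{i(c_w2 − c_w0)}]) · ∫_{A×A} fH((z₁,1)·(endoTorus L S c·(z₂,1))·(z₁,1)⁻¹) dΛ(z)`
— Harish-Chandra's `F_f^A` substitution at every split place at once; the right-hand side has no singularity at the real walls `x_w = 0`.
[cite: Varadarajan1989, §6.4 Lemma 21, Thm 23] [cite: Shelstad1979, §4 pp. 22–25] [cite: Rogawski1990, §8.2 pp. 119–122] [cite: Folland1995, §2.6 (2.52)] -/
theorem exists_leafMeasure_archRH_mul_chartOrbH_eq (fH : 𝔸[L] × 𝔹[L] → ℂ) (hfH : Continuous fH) :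
    ∃ (K₀ : ℝ) (Λ : Measure (𝔸[L] × 𝔸[L])) (Z : Set (𝔸[L] × 𝔸[L])),
      IsFiniteMeasureOnCompacts Λ ∧ IsClosed Z ∧ Λ Zᶜ = 0 ∧
      (∀ U : Set ({w : InfinitePlace L // IsComplex w} → Fin 3 → ℝ), IsCompact U → (∀ c ∈ U, ∀ w, w ∉ S → Circle.exp (c w 0) ≠ Circle.exp (c w 2)) →
        ∀ C : Set (𝔸[L] × 𝔹[L]), IsCompact C → ∃ 𝒮 : Set (𝔸[L] × 𝔸[L]), IsCompact 𝒮 ∧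
          ∀ z ∈ Z, ∀ c ∈ U, ((z.1, (1 : 𝔹[L])) * (endoTorus L S c * (z.2, (1 : 𝔹[L]))) * (z.1, (1 : 𝔹[L]))⁻¹) ∈ C → z ∈ 𝒮) ∧
      ∀ c : {w : InfinitePlace L // IsComplex w} → Fin 3 → ℝ, c ∈ RegS S →
        archRH S c * chartOrbH L νH S fH c =
          (K₀ : ℂ) * (∏ w, (if w ∈ S then ((Real.exp (c w 0) : ℝ) : ℂ) else 1 - (Circle.exp (c w 2 - c w 0) : ℂ))) *
            ∫ z, fH ((z.1, (1 : 𝔹[L])) * (endoTorus L S c * (z.2, (1 : 𝔹[L]))) * (z.1, (1 : 𝔹[L]))⁻¹) ∂Λ := by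
  -- instances at the places, on the quotients, on the chart tori
  haveI : ∀ w : {w : InfinitePlace L // IsComplex w}, LocallyCompactSpace ↥(archLocal L 2 Φ₂[L] w) := fun w => locallyCompactSpace_archLocal_two L w
  haveI : ∀ w : {w : InfinitePlace L // IsComplex w}, SecondCountableTopology ↥(archLocal L 2 Φ₂[L] w) := fun w => secondCountableTopology_archLocal_two L w
  letI : ∀ w : {w : InfinitePlace L // IsComplex w}, MeasurableSpace (↥(archLocal L 2 Φ₂[L] w) ⧸ chartTorusHLoc L S w) := fun w => borel _
  haveI : ∀ w : {w : InfinitePlace L // IsComplex w}, BorelSpace (↥(archLocal L 2 Φ₂[L] w) ⧸ chartTorusHLoc L S w) := fun w => ⟨rfl⟩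
  letI : MeasurableSpace ((𝔸[L] × 𝔹[L]) ⧸ chartTorusH L S) := borel _
  haveI : BorelSpace ((𝔸[L] × 𝔹[L]) ⧸ chartTorusH L S) := ⟨rfl⟩
  haveI : ∀ w, (chartHaarHLoc L S w).IsHaarMeasure := fun w => isHaarMeasure_chartHaarHLoc L S w
  haveI : ∀ w, (chartHaarHLoc L S w).IsInvInvariant := fun w => isInvInvariant_chartHaarHLoc L S w
  haveI : ∀ w, SigmaFinite (chartHaarHLoc L S w) := fun w => sigmaFinite_chartHaarHLoc L S w
  haveI : νB.IsInvInvariant := isInvInvariant_of_isHaarMeasure_archOne L νB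
  haveI := locallyCompactSpace_chartTorusH L S
  -- the product-quotient package
  obtain ⟨ρ, hρH, hρI, -, hcov, -⟩ := exists_haar_quotientMeasure_prod_pi_top (archPiEquivCM 2 L Φ₂[L])
    (fun w => chartTorusHLoc L S w) (fun w => isClosed_chartTorusHLoc L S w) (chartTorusH L S) (isClosed_chartTorusH L S)
    (mem_chartTorusH_iff_forall_mem_chartTorusHLoc L S) (fun w => chartHaarHLoc L S w) νw νB νH hν
  -- the per-place leaves
  choose Λw Zw Cw hΛfin hZcl hZnull hCne hprop hleaf using fun w : {w : InfinitePlace L // IsComplex w} => exists_placeLeaf L S w (νw w)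
  haveI : ∀ w, IsFiniteMeasureOnCompacts (Λw w) := hΛfin
  -- the fold `Π_w (G_w × G_w) → A × A` and its inverse
  set fold : (∀ w : {w : InfinitePlace L // IsComplex w}, ↥(archLocal L 2 Φ₂[L] w) × ↥(archLocal L 2 Φ₂[L] w)) → 𝔸[L] × 𝔸[L] :=
    fun z => ((archPiEquivCM 2 L Φ₂[L]).symm (fun w => (z w).1), (archPiEquivCM 2 L Φ₂[L]).symm (fun w => (z w).2)) with hfold
  set unfold : 𝔸[L] × 𝔸[L] → (∀ w : {w : InfinitePlace L // IsComplex w}, ↥(archLocal L 2 Φ₂[L] w) × ↥(archLocal L 2 Φ₂[L] w)) :=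
    fun a w => (archPiEquivCM 2 L Φ₂[L] a.1 w, archPiEquivCM 2 L Φ₂[L] a.2 w) with hunfold
  have hfold_c : Continuous fold :=
    ((archPiEquivCM 2 L Φ₂[L]).symm.continuous.comp (continuous_pi fun w => continuous_fst.comp (continuous_apply w))).prodMk
      ((archPiEquivCM 2 L Φ₂[L]).symm.continuous.comp (continuous_pi fun w => continuous_snd.comp (continuous_apply w)))
  have hunfold_c : Continuous unfold :=
    continuous_pi fun w => ((continuous_apply w).comp ((archPiEquivCM 2 L Φ₂[L]).continuous.comp continuous_fst)).prodMk
      ((continuous_apply w).comp ((archPiEquivCM 2 L Φ₂[L]).continuous.comp continuous_snd))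
  have h_uf : ∀ z, unfold (fold z) = z := fun z => by
    funext w
    simp only [hfold, hunfold, ContinuousMulEquiv.apply_symm_apply]
  have h_fu : ∀ a, fold (unfold a) = a := fun a => by
    simp only [hfold, hunfold]
    exact Prod.ext ((archPiEquivCM 2 L Φ₂[L]).symm_apply_apply a.1) ((archPiEquivCM 2 L Φ₂[L]).symm_apply_apply a.2)
  refine ⟨(ρ (chartBoxImg L S)).toReal * ∏ w, (Cw w : ℝ), Measure.map fold (Measure.pi Λw), unfold ⁻¹' Set.pi Set.univ Zw, ?_, ?_, ?_, ?_, ?_⟩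
  · -- finite on compacta
    refine ⟨fun C hC => ?_⟩
    rw [Measure.map_apply hfold_c.measurable hC.measurableSet]
    have hsub : fold ⁻¹' C ⊆ unfold '' C := fun z hz => ⟨fold z, hz, h_uf z⟩
    exact lt_of_le_of_lt (measure_mono hsub) ((hC.image hunfold_c).measure_lt_top)
  · -- closed leaf
    exact (isClosed_set_pi fun w _ => hZcl w).preimage hunfold_c
  · -- the leaf carries `Λ`
    rw [Measure.map_apply hfold_c.measurable ((isClosed_set_pi fun w _ => hZcl w).preimage hunfold_c).measurableSet.compl]
    have hsub : fold ⁻¹' (unfold ⁻¹' Set.pi Set.univ Zw)ᶜ ⊆ ⋃ w, Function.eval w ⁻¹' (Zw w)ᶜ := by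
      intro z hz
      simp only [Set.mem_preimage, Set.mem_compl_iff, h_uf, Set.mem_univ_pi, not_forall] at hz
      obtain ⟨w, hw⟩ := hz
      exact Set.mem_iUnion.2 ⟨w, hw⟩
    exact measure_mono_null hsub (measure_iUnion_null fun w => pi_eval_preimage_null Λw (hZnull w))
  · -- properness on the leaf
    intro U hU hreg C hC
    have hCw : ∀ w : {w : InfinitePlace L // IsComplex w}, IsCompact ((fun u : (∀ w' : {w : InfinitePlace L // IsComplex w},
        ↥(archLocal L 2 Φ₂[L] w')) => u w) '' (archPiEquivCM 2 L Φ₂[L] '' (Prod.fst '' C))) := fun w =>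
      ((hC.image continuous_fst).image (archPiEquivCM 2 L Φ₂[L]).continuous).image (continuous_apply w)
    choose 𝒮w h𝒮c h𝒮 using fun w => hprop w U hU (fun hw c hc => hreg c hc w hw) _ (hCw w)
    refine ⟨fold '' Set.pi Set.univ 𝒮w, (isCompact_univ_pi h𝒮c).image hfold_c, fun z hz c hcU hmem => ?_⟩
    refine ⟨unfold z, fun w _ => h𝒮 w (unfold z w) (hz w (Set.mem_univ w)) c hcU ?_, h_fu z⟩
    refine ⟨archPiEquivCM 2 L Φ₂[L] (((z.1, (1 : 𝔹[L])) * (endoTorus L S c * (z.2, (1 : 𝔹[L]))) * (z.1, (1 : 𝔹[L]))⁻¹).1),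
      ⟨_, ⟨_, hmem, rfl⟩, rfl⟩, ?_⟩
    simp only [hunfold, Prod.fst_mul, Prod.fst_inv, map_mul, map_inv, Pi.mul_apply, Pi.inv_apply, archPiEquivCM_endoTorus_fst, endoBlock_eq_endoBlockAt]
  · -- the identity on the regular set
    intro c hc
    have hc1 : ∀ w, w ∈ S → c w 0 ≠ 0 := ((mem_regS_iff S c).1 hc).2
    -- (1) Haar-freeness + the package
    have hint : ∫ y, descConj (endoTorus L S c) (chartTorusH L S) (forall_mem_chartTorusH_comm L S c) fH y
        ∂(quotientMeasure (chartTorusH L S) ρ (isClosed_chartTorusH L S) νH) =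
        ∫ p, fH ((archPiEquivCM 2 L Φ₂[L]).symm (fun w => descConj (endoBlockAt L S w (c w)) (chartTorusHLoc L S w)
          (forall_mem_chartTorusHLoc_comm L S w (c w)) id (p w)), (endoTorus L S c).2)
          ∂(Measure.pi fun w => quotientMeasure (chartTorusHLoc L S w) (chartHaarHLoc L S w) (isClosed_chartTorusHLoc L S w) (νw w)) :=
      hcov (fun w => endoBlockAt L S w (c w)) (endoTorus L S c).2 (fun w => forall_mem_chartTorusHLoc_comm L S w (c w))
        (forall_mem_chartTorusH_comm L S c) fH
    -- (2) the orbital measures of the places and their leaves (`m w` the leaf parametrisation, `Φ` the integrand on `Π_w G_w`, `dsc` the scalars)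
    let m : ∀ w : {w : InfinitePlace L // IsComplex w}, ↥(archLocal L 2 Φ₂[L] w) × ↥(archLocal L 2 Φ₂[L] w) → ↥(archLocal L 2 Φ₂[L] w) :=
      fun w z => z.1 * (endoBlockAt L S w (c w) * z.2) * z.1⁻¹
    have hm_c : ∀ w, Continuous (m w) := fun w => (continuous_fst.mul (continuous_const.mul continuous_snd)).mul continuous_fst.inv
    let Φ : (∀ w : {w : InfinitePlace L // IsComplex w}, ↥(archLocal L 2 Φ₂[L] w)) → ℂ :=
      fun g => fH ((archPiEquivCM 2 L Φ₂[L]).symm g, (endoTorus L S c).2)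
    have hΦ_c : Continuous Φ := hfH.comp (((archPiEquivCM 2 L Φ₂[L]).symm.continuous).prodMk continuous_const)
    let dsc : {w : InfinitePlace L // IsComplex w} → ℝ≥0 := fun w => Cw w * (if w ∈ S then ‖(((Real.exp (-2 * c w 0) : ℝ) : ℂ)) - 1‖₊⁻¹ else 1)
    have hD_c : Continuous (fun (p : ∀ w : {w : InfinitePlace L // IsComplex w}, ↥(archLocal L 2 Φ₂[L] w) ⧸ chartTorusHLoc L S w)
        (w : {w : InfinitePlace L // IsComplex w}) =>
        descConj (endoBlockAt L S w (c w)) (chartTorusHLoc L S w) (forall_mem_chartTorusHLoc_comm L S w (c w)) id (p w)) :=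
      continuous_pi fun w => (continuous_descConj (endoBlockAt L S w (c w)) (chartTorusHLoc L S w) _ continuous_id).comp (continuous_apply w)
    have hM_c : Continuous (fun (z : ∀ w : {w : InfinitePlace L // IsComplex w}, ↥(archLocal L 2 Φ₂[L] w) × ↥(archLocal L 2 Φ₂[L] w))
        (w : {w : InfinitePlace L // IsComplex w}) => m w (z w)) :=
      continuous_pi fun w => (hm_c w).comp (continuous_apply w)
    have hO : ∀ w, (quotientMeasure (chartTorusHLoc L S w) (chartHaarHLoc L S w) (isClosed_chartTorusHLoc L S w) (νw w)).map
        (descConj (endoBlockAt L S w (c w)) (chartTorusHLoc L S w) (forall_mem_chartTorusHLoc_comm L S w (c w)) id) = dsc w • (Λw w).map (m w) :=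
      fun w => hleaf w c (hc1 w)
    -- the leaf images are finite on compacta (properness at the single point `c`), hence σ-finite
    have hmfin : ∀ w, IsFiniteMeasureOnCompacts ((Λw w).map (m w)) := by
      intro w
      refine isFiniteMeasureOnCompacts_map_of_leaf (Λw w) (hZnull w) (hm_c w) fun C' hC' => ?_
      obtain ⟨𝒮, h𝒮, h⟩ := hprop w {c} isCompact_singleton (fun hw c' hc' => by
        rw [Set.mem_singleton_iff.1 hc']; exact ((mem_regS_iff S c).1 hc).1 w hw) C' hC'
      exact ⟨𝒮, h𝒮, fun z hz hzC => h z hz c (Set.mem_singleton c) hzC⟩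
    haveI : ∀ w, SigmaFinite ((Λw w).map (m w)) := fun w => by haveI := hmfin w; infer_instance
    haveI : ∀ w, SigmaFinite ((quotientMeasure (chartTorusHLoc L S w) (chartHaarHLoc L S w) (isClosed_chartTorusHLoc L S w) (νw w)).map
        (descConj (endoBlockAt L S w (c w)) (chartTorusHLoc L S w) (forall_mem_chartTorusHLoc_comm L S w (c w)) id)) := fun w => by
      rw [hO w]; haveI := hmfin w; infer_instance
    -- (3) assemble: package → image of the product of quotient measures → product of leaves → fold
    have hstep : ∫ p, fH ((archPiEquivCM 2 L Φ₂[L]).symm (fun w => descConj (endoBlockAt L S w (c w)) (chartTorusHLoc L S w)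
          (forall_mem_chartTorusHLoc_comm L S w (c w)) id (p w)), (endoTorus L S c).2)
          ∂(Measure.pi fun w => quotientMeasure (chartTorusHLoc L S w) (chartHaarHLoc L S w) (isClosed_chartTorusHLoc L S w) (νw w)) =
        (∏ w, dsc w) • ∫ z, fH ((z.1, (1 : 𝔹[L])) * (endoTorus L S c * (z.2, (1 : 𝔹[L]))) * (z.1, (1 : 𝔹[L]))⁻¹) ∂(Measure.map fold (Measure.pi Λw)) := by
      -- as an integral of `Φ` against the image measure, then `pi_map_pi`, the leaves, `pi_nnreal_smul_map`, and the fold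
      have h1 : (fun p : (∀ w : {w : InfinitePlace L // IsComplex w}, ↥(archLocal L 2 Φ₂[L] w) ⧸ chartTorusHLoc L S w) =>
          fH ((archPiEquivCM 2 L Φ₂[L]).symm (fun w => descConj (endoBlockAt L S w (c w)) (chartTorusHLoc L S w)
            (forall_mem_chartTorusHLoc_comm L S w (c w)) id (p w)), (endoTorus L S c).2)) =
          fun p => Φ (fun w => descConj (endoBlockAt L S w (c w)) (chartTorusHLoc L S w) (forall_mem_chartTorusHLoc_comm L S w (c w)) id (p w)) := rfl
      rw [h1, ← integral_map hD_c.measurable.aemeasurable hΦ_c.aestronglyMeasurable,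
        Measure.pi_map_pi (fun w => (continuous_descConj (endoBlockAt L S w (c w)) (chartTorusHLoc L S w) _ continuous_id).measurable.aemeasurable)]
      have h2 : (Measure.pi fun w => (quotientMeasure (chartTorusHLoc L S w) (chartHaarHLoc L S w) (isClosed_chartTorusHLoc L S w) (νw w)).map
          (descConj (endoBlockAt L S w (c w)) (chartTorusHLoc L S w) (forall_mem_chartTorusHLoc_comm L S w (c w)) id)) =
          Measure.pi fun w => dsc w • (Λw w).map (m w) := congrArg Measure.pi (funext hO)
      rw [h2, pi_nnreal_smul_map Λw m (fun w => (hm_c w).measurable) dsc, integral_smul_nnreal_measure,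
        integral_map hM_c.measurable.aemeasurable hΦ_c.aestronglyMeasurable,
        integral_map hfold_c.measurable.aemeasurable]
      · congr 1
        refine integral_congr_ae (Filter.Eventually.of_forall fun z => ?_)
        show fH _ = fH _
        congr 1
        refine Prod.ext ?_ ?_
        · apply (archPiEquivCM 2 L Φ₂[L]).injective
          funext w
          simp only [hfold, Prod.fst_mul, Prod.fst_inv, map_mul, map_inv, ContinuousMulEquiv.apply_symm_apply, Pi.mul_apply, Pi.inv_apply,
            archPiEquivCM_endoTorus_fst, endoBlock_eq_endoBlockAt, m]
        · simp only [hfold, Prod.snd_mul, Prod.snd_inv, one_mul, mul_one, inv_one]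
      · exact (hfH.comp ((((continuous_fst.prodMk continuous_const).mul (continuous_const.mul (continuous_snd.prodMk continuous_const))).mul
          (continuous_fst.prodMk continuous_const).inv))).aestronglyMeasurable
    -- (4) scalars
    rw [chartOrbH_eq_of_isHaarMeasure L S νH ρ fH c]
    show archRH S c * (((ρ (chartBoxImg L S)).toReal : ℂ) * ∫ y, descConj (endoTorus L S c) (chartTorusH L S) (forall_mem_chartTorusH_comm L S c) fH y
        ∂(quotientMeasure (chartTorusH L S) ρ (isClosed_chartTorusH L S) νH)) = _
    rw [hint, hstep]
    have hfac : ∀ w, (if w ∈ S then ((|Real.exp (c w 0) - Real.exp (-c w 0)| : ℝ) : ℂ) else 1 - (Circle.exp (c w 2 - c w 0) : ℂ)) * ((dsc w : ℝ) : ℂ) =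
        ((Cw w : ℝ) : ℂ) * (if w ∈ S then ((Real.exp (c w 0) : ℝ) : ℂ) else 1 - (Circle.exp (c w 2 - c w 0) : ℂ)) := by
      intro w
      by_cases hw : w ∈ S
      · simp only [dsc, if_pos hw, NNReal.coe_mul, NNReal.coe_inv, coe_nnnorm, Complex.ofReal_mul, Complex.ofReal_inv]
        have h := abs_exp_sub_exp_neg_mul_norm_inv (c w 0) (hc1 w hw)
        calc ((|Real.exp (c w 0) - Real.exp (-c w 0)| : ℝ) : ℂ) * (((Cw w : ℝ) : ℂ) * (((‖(((Real.exp (-2 * c w 0) : ℝ) : ℂ)) - 1‖ : ℝ) : ℂ))⁻¹)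
            = ((Cw w : ℝ) : ℂ) * (((|Real.exp (c w 0) - Real.exp (-c w 0)| * ‖(((Real.exp (-2 * c w 0) : ℝ) : ℂ)) - 1‖⁻¹ : ℝ)) : ℂ) := by
              push_cast; ring
          _ = ((Cw w : ℝ) : ℂ) * ((Real.exp (c w 0) : ℝ) : ℂ) := by rw [h]
      · simp only [dsc, if_neg hw, mul_one]
        ring
    have harch : archRH S c = ∏ w, (if w ∈ S then ((|Real.exp (c w 0) - Real.exp (-c w 0)| : ℝ) : ℂ) else 1 - (Circle.exp (c w 2 - c w 0) : ℂ)) := by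
      unfold archRH
      exact Finset.prod_congr rfl fun w _ => by congr 1
    rw [NNReal.smul_def, Complex.real_smul, NNReal.coe_prod, Complex.ofReal_prod, harch, Complex.ofReal_mul, Complex.ofReal_prod]
    have hprod : (∏ w, (if w ∈ S then ((|Real.exp (c w 0) - Real.exp (-c w 0)| : ℝ) : ℂ) else 1 - (Circle.exp (c w 2 - c w 0) : ℂ))) * ∏ w, ((dsc w : ℝ) : ℂ) =
        (∏ w, ((Cw w : ℝ) : ℂ)) * ∏ w, (if w ∈ S then ((Real.exp (c w 0) : ℝ) : ℂ) else 1 - (Circle.exp (c w 2 - c w 0) : ℂ)) := by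
      rw [← Finset.prod_mul_distrib, ← Finset.prod_mul_distrib]
      exact Finset.prod_congr rfl fun w _ => hfac w
    calc (∏ w, (if w ∈ S then ((|Real.exp (c w 0) - Real.exp (-c w 0)| : ℝ) : ℂ) else 1 - (Circle.exp (c w 2 - c w 0) : ℂ))) *
          (((ρ (chartBoxImg L S)).toReal : ℂ) * ((∏ w, ((dsc w : ℝ) : ℂ)) *
            ∫ z, fH ((z.1, (1 : 𝔹[L])) * (endoTorus L S c * (z.2, (1 : 𝔹[L]))) * (z.1, (1 : 𝔹[L]))⁻¹) ∂(Measure.map fold (Measure.pi Λw))))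
        = ((ρ (chartBoxImg L S)).toReal : ℂ) * (((∏ w, (if w ∈ S then ((|Real.exp (c w 0) - Real.exp (-c w 0)| : ℝ) : ℂ) else 1 - (Circle.exp (c w 2 - c w 0) : ℂ))) *
            ∏ w, ((dsc w : ℝ) : ℂ)) *
            ∫ z, fH ((z.1, (1 : 𝔹[L])) * (endoTorus L S c * (z.2, (1 : 𝔹[L]))) * (z.1, (1 : 𝔹[L]))⁻¹) ∂(Measure.map fold (Measure.pi Λw))) := by ring
      _ = _ := by rw [hprod]; ring

end Assembly

section AnyHaar

local notation3 "𝔸[" L "]" => ↥(arch (↥(maximalRealSubfield L)) L (IsCMField.complexConj L) 2 Φ₂[L])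
local notation3 "𝔹[" L "]" => ↥(arch (↥(maximalRealSubfield L)) L (IsCMField.complexConj L) 1 Φ₁[L])

variable (L : Type) [Field L] [NumberField L] [IsCMField L] (S : Finset {w : InfinitePlace L // IsComplex w})
  [MeasurableSpace 𝔸[L]] [BorelSpace 𝔸[L]] [MeasurableSpace 𝔹[L]] [BorelSpace 𝔹[L]]
  (νH : Measure (𝔸[L] × 𝔹[L])) [νH.IsHaarMeasure] [νH.IsMulRightInvariant]

/-- **UNIFORM UNFOLDING FOR AN ARBITRARY HAAR MEASURE `νH` ON `H_∞`** (★ `chartOrbH_eq_haarScalarFactor_mul`: `νH = κ • ν₀` for the product convention `ν₀` built from the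
Haar measures of the places; the constant `κ` is absorbed in `K₀`).  Same conclusion as ★ `exists_leafMeasure_archRH_mul_chartOrbH_eq`.
[cite: Folland1995, §2.2; §2.6 (2.52)] [cite: Varadarajan1989, §6.4 Lemma 21, Thm 23] [cite: Shelstad1979, §4 pp. 22–25] -/
theorem exists_leafMeasure_archRH_mul_chartOrbH_eq_of_isHaarMeasure (fH : 𝔸[L] × 𝔹[L] → ℂ) (hfH : Continuous fH) :
    ∃ (K₀ : ℝ) (Λ : Measure (𝔸[L] × 𝔸[L])) (Z : Set (𝔸[L] × 𝔸[L])),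
      IsFiniteMeasureOnCompacts Λ ∧ IsClosed Z ∧ Λ Zᶜ = 0 ∧
      (∀ U : Set ({w : InfinitePlace L // IsComplex w} → Fin 3 → ℝ), IsCompact U → (∀ c ∈ U, ∀ w, w ∉ S → Circle.exp (c w 0) ≠ Circle.exp (c w 2)) →
        ∀ C : Set (𝔸[L] × 𝔹[L]), IsCompact C → ∃ 𝒮 : Set (𝔸[L] × 𝔸[L]), IsCompact 𝒮 ∧
          ∀ z ∈ Z, ∀ c ∈ U, ((z.1, (1 : 𝔹[L])) * (endoTorus L S c * (z.2, (1 : 𝔹[L]))) * (z.1, (1 : 𝔹[L]))⁻¹) ∈ C → z ∈ 𝒮) ∧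
      ∀ c : {w : InfinitePlace L // IsComplex w} → Fin 3 → ℝ, c ∈ RegS S →
        archRH S c * chartOrbH L νH S fH c =
          (K₀ : ℂ) * (∏ w, (if w ∈ S then ((Real.exp (c w 0) : ℝ) : ℂ) else 1 - (Circle.exp (c w 2 - c w 0) : ℂ))) *
            ∫ z, fH ((z.1, (1 : 𝔹[L])) * (endoTorus L S c * (z.2, (1 : 𝔹[L]))) * (z.1, (1 : 𝔹[L]))⁻¹) ∂Λ := by
  -- the places: Borel structures and Haar measures
  letI : ∀ w : {w : InfinitePlace L // IsComplex w}, MeasurableSpace ↥(archLocal L 2 Φ₂[L] w) := fun w => borel _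
  haveI : ∀ w : {w : InfinitePlace L // IsComplex w}, BorelSpace ↥(archLocal L 2 Φ₂[L] w) := fun w => ⟨rfl⟩
  haveI : ∀ w : {w : InfinitePlace L // IsComplex w}, LocallyCompactSpace ↥(archLocal L 2 Φ₂[L] w) := fun w => locallyCompactSpace_archLocal_two L w
  haveI : ∀ w : {w : InfinitePlace L // IsComplex w}, SecondCountableTopology ↥(archLocal L 2 Φ₂[L] w) := fun w => secondCountableTopology_archLocal_two L w
  obtain ⟨νw, hνw⟩ : ∃ νw : ∀ w : {w : InfinitePlace L // IsComplex w}, Measure ↥(archLocal L 2 Φ₂[L] w), ∀ w, (νw w).IsHaarMeasure :=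
    ⟨fun w => Measure.haar, fun w => inferInstance⟩
  haveI : ∀ w, (νw w).IsHaarMeasure := hνw
  haveI : ∀ w : {w : InfinitePlace L // IsComplex w}, (νw w).IsMulRightInvariant := fun w => by
    haveI : LocallyCompactSpace ↥(unitaryGroupOfForm (starRingEnd ℂ) ((Φ₂[L]).map w.1.embedding)) := locallyCompactSpace_archLocal_two L w
    have h1 : ∀ g : ↥(archLocal L 2 Φ₂[L] w), modularCharacterFun g = 1 := fun g =>
      modularCharacterFun_eq_one_of_eq_over_antidiagonal_two (map_embedding_antidiagTwo_eq_over L w) g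
    exact isMulRightInvariant_of_modularCharacterFun_eq_one (G := ↥(archLocal L 2 Φ₂[L] w)) h1 (νw w)
  obtain ⟨νB, hνB⟩ : ∃ νB : Measure 𝔹[L], νB.IsHaarMeasure := ⟨Measure.haar, inferInstance⟩
  haveI := hνB
  haveI : νB.IsMulRightInvariant := (forall_measure_preimage_mul_right_iff νB).1 fun g A _ => by
    have h : (fun h : 𝔹[L] => h * g) = fun h => g * h := funext fun h => archOne_mul_comm L h g
    rw [h, measure_preimage_mul]
  haveI := isHaarMeasure_prodConventionH L νw νB
  haveI := isMulRightInvariant_prodConventionH L νw νB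
  obtain ⟨K₀, Λ, Z, hΛ, hZ, hnull, hprop, hid⟩ := exists_leafMeasure_archRH_mul_chartOrbH_eq L S νw νB
    (((Measure.pi νw).map (archPiEquivCM 2 L Φ₂[L]).symm).prod νB) rfl fH hfH
  refine ⟨haarScalarFactor νH (((Measure.pi νw).map (archPiEquivCM 2 L Φ₂[L]).symm).prod νB) * K₀, Λ, Z, hΛ, hZ, hnull, hprop, fun c hc => ?_⟩
  rw [chartOrbH_eq_haarScalarFactor_mul L S νH (((Measure.pi νw).map (archPiEquivCM 2 L Φ₂[L]).symm).prod νB) fH c, ← mul_assoc,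
    mul_comm (archRH S c), mul_assoc, hid c hc, Complex.ofReal_mul]
  ring

end AnyHaar



end Literature.NumberTheory.Automorphic.UnitaryGroup

end
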